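import Mathlib

/-!
# Solo/informed — kernel artefact 3b: the augmentation ideal of `𝔽_p[C]` is nilpotent of index `≤ p`

For a commutative group `G`, a prime `p` and `g : G` with `g ^ p = 1`, in the group algebra
`MonoidAlgebra (ZMod p) G` one has `(g - 1) ^ p = 0`.  Consequently, for `G` cyclic of order `p`
generated by `g`, the group algebra is the truncated polynomial ring `𝔽_p[ε]/(ε^p)` with
`ε = g - 1`, which is the algebra behind clause (γ) of (E5) in Part II §7.8: a deformation of the
trivial character along an unramified `ℤ/p`-direction to order `p - 1` is an `𝔽_p[C]`-module,
so Shapiro's lemma applies.  Pure algebra; no arithmetic input.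
-/

namespace Summit.Langlands.Langlands.Theorems

open MonoidAlgebra

/-- In the group algebra `𝔽_p[G]` of a commutative group, `(g - 1) ^ p = 0` whenever `g ^ p = 1`:
the Frobenius identity `(x - y)^p = x^p - y^p` in characteristic `p`. -/
theorem soloInformed_of_sub_one_pow_char {p : ℕ} [hp : Fact p.Prime] {G : Type*} [CommGroup G]
    (g : G) (hg : g ^ p = 1) :
    (MonoidAlgebra.of (ZMod p) G g - 1) ^ p = 0 := by
  haveI : CharP (MonoidAlgebra (ZMod p) G) p :=
    charP_of_injective_algebraMap (algebraMap (ZMod p) (MonoidAlgebra (ZMod p) G)).injective p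
  rw [sub_pow_char (MonoidAlgebra.of (ZMod p) G g) 1, one_pow, ← map_pow, hg, map_one, sub_self]

/-- Iterated version: `(g - 1) ^ (p ^ k) = 0` as soon as `g ^ (p ^ k) = 1`. -/
theorem soloInformed_of_sub_one_pow_char_pow {p : ℕ} [hp : Fact p.Prime] {G : Type*} [CommGroup G]
    (g : G) (k : ℕ) (hg : g ^ (p ^ k) = 1) :
    (MonoidAlgebra.of (ZMod p) G g - 1) ^ (p ^ k) = 0 := by
  haveI : CharP (MonoidAlgebra (ZMod p) G) p :=
    charP_of_injective_algebraMap (algebraMap (ZMod p) (MonoidAlgebra (ZMod p) G)).injective p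
  rw [sub_pow_char_pow (MonoidAlgebra.of (ZMod p) G g) 1 k, one_pow, ← map_pow, hg, map_one,
    sub_self]

/-- Hence every element of the augmentation ideal of `𝔽_p[G]`, `G` a finite commutative
`p`-group of exponent dividing `p ^ k`, is nilpotent: `(x - aug x) ^ (p ^ k) = 0` for `x = of g`
is the generator case; we record the consequence that `of g` is unipotent. -/
theorem soloInformed_of_isUnipotent {p : ℕ} [hp : Fact p.Prime] {G : Type*} [CommGroup G]
    (g : G) (k : ℕ) (hg : g ^ (p ^ k) = 1) :
    IsNilpotent (MonoidAlgebra.of (ZMod p) G g - 1) :=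
  ⟨p ^ k, soloInformed_of_sub_one_pow_char_pow g k hg⟩

end Summit.Langlands.Langlands.Theorems
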